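import Literature.Analysis.FluidPDE.ElgindiEllipticInteriorRegularity
import Literature.Analysis.FluidPDE.ElgindiOperatorLocality
import Literature.Analysis.Distribution.SmoothCutoff
import Mathlib.Analysis.Distribution.AEEqOfIntegralContDiff
import HarnessLib

/-!
# The weak solution of Elgindi's polar elliptic problem is a classical solution on the open strip
([Elgindi2021] §7.1, Proposition 7.1)

Topic `Literature/Analysis/FluidPDE`. Support file (definitions with bodies and proved theorems, no
named facts) on the proof path of the named fact
`Literature.Analysis.FluidPDE.Elgindi.ElgindiGhoulMasmoudi2021_stabilityCore`
(`ElgindiStabilityDecomposition.lean`). T. M. Elgindi, Ann. of Math. 194 (2021) =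
arXiv:1904.04795, §7.1 Proposition 7.1 (p. 19 of the held text).

* `exists_smooth_rep_of_local` — patching of local smooth representatives on an open subset of
  `ℝ²` (Lindelöf);
* `exists_smooth_rep` — the first component `U₀` of the weak solution with smooth datum `f ⊥ K`
  agrees a.e. on the strip with a function `Ψ ∈ C^∞(strip)`;
* `integral_ellipticOp_mul_test` — `∫∫ L(Ψ̃)Φ = ∫∫ Ψ̃ ᵗL(Φ)` for smooth `Ψ̃, Φ` compactly supported
  in the open strip (Green's identity and the graph integrations by parts);
* `exists_test_eqOn` — localisation of a `C^∞(strip)` function to the compactly supported class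
  near a compact set (Hörmander's cutoff, `exists_smooth_cutoff`);
* `ellipticOp_rep_eq` — **the smooth representative solves `L(Ψ) = f` pointwise on the open
  strip** (fundamental lemma of the calculus of variations).
-/

noncomputable section

open MeasureTheory Set Real Filter Function Metric
open _root_.Topology
open scoped ENNReal InnerProductSpace ContDiff

namespace Literature.Analysis.FluidPDE

namespace Elgindi

open Literature.Analysis.Distribution

/-! ### Patching local smooth representatives -/

/-- **Patching**: if `u` is locally a.e. equal to smooth functions on the open set `Ω ⊆ ℝ²`, it is
a.e. equal on `Ω` to one function smooth on `Ω`. [folklore] -/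
theorem exists_smooth_rep_of_local {Ω : Set (ℝ × ℝ)} (hΩ : IsOpen Ω) {u : ℝ × ℝ → ℝ}
    (hloc : ∀ x ∈ Ω, ∃ V : Set (ℝ × ℝ), IsOpen V ∧ x ∈ V ∧ V ⊆ Ω ∧
      ∃ g : ℝ × ℝ → ℝ, ContDiffOn ℝ ∞ g V ∧ ∀ᵐ y ∂(volume : Measure (ℝ × ℝ)), y ∈ V → u y = g y) :
    ∃ Ψ : ℝ × ℝ → ℝ, ContDiffOn ℝ ∞ Ψ Ω ∧ ∀ᵐ y ∂(volume : Measure (ℝ × ℝ)), y ∈ Ω → u y = Ψ y := by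
  classical
  have _hΩ := hΩ
  choose V hV hxV hVΩ g hg hae using hloc
  -- two local representatives agree on the overlap
  have hagree : ∀ x (hx : x ∈ Ω) y (hy : y ∈ Ω), EqOn (g x hx) (g y hy) (V x hx ∩ V y hy) := by
    intro x hx y hy
    have hO : IsOpen (V x hx ∩ V y hy) := (hV x hx).inter (hV y hy)
    refine Measure.eqOn_open_of_ae_eq (μ := (volume : Measure (ℝ × ℝ))) ?_ hO ((hg x hx).continuousOn.mono inter_subset_left)
      ((hg y hy).continuousOn.mono inter_subset_right)
    rw [Filter.EventuallyEq, ae_restrict_iff' hO.measurableSet]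
    filter_upwards [hae x hx, hae y hy] with z h1 h2 hz
    rw [← h1 hz.1, ← h2 hz.2]
  set Ψ : ℝ × ℝ → ℝ := fun z => if hz : z ∈ Ω then g z hz z else 0 with hΨ
  have hΨV : ∀ x (hx : x ∈ Ω), ∀ z ∈ V x hx, Ψ z = g x hx z := by
    intro x hx z hz
    have hzΩ : z ∈ Ω := hVΩ x hx hz
    simp only [hΨ, dif_pos hzΩ]
    exact hagree z hzΩ x hx ⟨hxV z hzΩ, hz⟩
  refine ⟨Ψ, fun x hx => ?_, ?_⟩
  · have h1 : ContDiffAt ℝ ∞ (g x hx) x := (hg x hx).contDiffAt ((hV x hx).mem_nhds (hxV x hx))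
    have h2 : Ψ =ᶠ[𝓝 x] g x hx := by
      filter_upwards [(hV x hx).mem_nhds (hxV x hx)] with z hz using hΨV x hx z hz
    exact (h1.congr_of_eventuallyEq h2).contDiffWithinAt
  · -- a countable subcover
    obtain ⟨T, hTc, hTU⟩ := TopologicalSpace.isOpen_iUnion_countable (fun i : Ω => V i.1 i.2) fun i => hV i.1 i.2
    have hcov : Ω ⊆ ⋃ i ∈ T, V i.1 i.2 := by
      rw [hTU]; intro z hz; exact mem_iUnion.2 ⟨⟨z, hz⟩, hxV z hz⟩
    haveI : Countable T := hTc.to_subtype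
    have hall : ∀ᵐ y ∂(volume : Measure (ℝ × ℝ)), ∀ i : T, y ∈ V i.1.1 i.1.2 → u y = g i.1.1 i.1.2 y :=
      ae_all_iff.2 fun i => hae i.1.1 i.1.2
    filter_upwards [hall] with y hy hyΩ
    obtain ⟨i, hi⟩ := mem_iUnion.1 (hcov hyΩ)
    obtain ⟨hiT, hyi⟩ := mem_iUnion.1 hi
    rw [hy ⟨i, hiT⟩ hyi, hΨV i.1 i.2 y hyi]

/-- **A smooth representative of `U₀` on the whole strip.** [cite: Elgindi2021, §7.1 Proposition 7.1 (p. 19 of arXiv:1904.04795), via Folland 1995 Cor. (6.34)] -/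
theorem exists_smooth_rep {α : ℝ} (hα : 0 < α) {f : ℝ × ℝ → ℝ} (hfc : Continuous f) (hfs : HasCompactSupport f)
    (hf : ContDiffOn ℝ ∞ f strip)
    (HF : ∀ n : ℝ → ℝ, Continuous n → HasCompactSupport n → ∫ p in strip, f p * (n p.1 * kernelK p.2) = 0)
    {U : E4} (hU : U ∈ weakSpace α) (hw : ∀ Ψ ∈ weakSpace α, energyForm α U Ψ = ⟪toL2 f, Ψ 0⟫_ℝ) :
    ∃ Ψ : ℝ × ℝ → ℝ, ContDiffOn ℝ ∞ Ψ strip ∧ ∀ᵐ y ∂(volume : Measure (ℝ × ℝ)), y ∈ strip → (U 0 : ℝ × ℝ → ℝ) y = Ψ y :=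
  exists_smooth_rep_of_local isOpen_strip fun _ hx => exists_local_smooth_rep hα hfc hfs hf HF hU hw hx

/-! ### `∫∫ L(Ψ̃)Φ = ∫∫ Ψ̃ ᵗL(Φ)` for smooth functions compactly supported in the open strip -/

set_option maxHeartbeats 1600000 in
/-- **The transpose identity** for smooth `Ψ̃, Φ` compactly supported in the open strip:
`∫∫_strip L(Ψ̃)Φ = ∫∫_strip Ψ̃ ᵗL(Φ)`. [folklore] -/
theorem integral_ellipticOp_mul_test (α : ℝ) {Ψt Φ : ℝ → ℝ → ℝ} (hΨn : ∀ n : ℕ, ContDiff ℝ n (uncurry Ψt))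
    (hΨs : HasCompactSupport (uncurry Ψt)) (hΨS : tsupport (uncurry Ψt) ⊆ strip)
    (hΦn : ∀ n : ℕ, ContDiff ℝ n (uncurry Φ)) (hΦs : HasCompactSupport (uncurry Φ)) (hΦS : tsupport (uncurry Φ) ⊆ strip) :
    ∫ p in strip, ellipticOp α Ψt p.1 p.2 * Φ p.1 p.2 = ∫ p in strip, Ψt p.1 p.2 * transposeOp α Φ p := by
  obtain ⟨χ₁, h1n, h1s, h1pos, h10, hcos1⟩ := exists_profile_of_test hΨn hΨs hΨS
  obtain ⟨χ₂, h2n, h2s, h2pos, h20, hcos2⟩ := exists_profile_of_test hΦn hΦs hΦS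
  have hG := integral_strip_ellipticOp_mul_eq_weak α (h1n 2) h1s h1pos (h2n 1) h2s h2pos h20 hcos1.symm
  have h11 : ContDiff ℝ 1 (uncurry χ₁) := h1n 1
  have h21 : ContDiff ℝ 1 (uncurry χ₂) := h2n 1
  have hΦ2 : ContDiff ℝ 2 (uncurry Φ) := hΦn 2
  have hΦ1 : ContDiff ℝ 1 (uncurry Φ) := hΦn 1
  -- graph components
  have g10 : graphFn α χ₁ 0 = fun p => Ψt p.1 p.2 := by
    funext p; show Real.cos p.2 * χ₁ p.1 p.2 = Ψt p.1 p.2; rw [← hcos1]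
  have g20 : graphFn α χ₂ 0 = fun p => Φ p.1 p.2 := by
    funext p; show Real.cos p.2 * χ₂ p.1 p.2 = Φ p.1 p.2; rw [← hcos2]
  have g21 : graphFn α χ₂ 1 = fun p => α * (p.1 * dz Φ p.1 p.2) := by
    funext p
    show α * (p.1 * (Real.cos p.2 * dz χ₂ p.1 p.2)) = α * (p.1 * dz Φ p.1 p.2)
    rw [← dz_cosProfile h21, hcos2]
  have g22 : graphFn α χ₂ 2 = fun p => dθ Φ p.1 p.2 := by
    funext p
    show -Real.sin p.2 * χ₂ p.1 p.2 + Real.cos p.2 * dθ χ₂ p.1 p.2 = dθ Φ p.1 p.2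
    rw [← dθ_cosProfile h21, hcos2]
  rw [g20] at hG
  rw [hG, g21, g22, g10]
  simp only []
  -- the auxiliary test functions
  obtain ⟨φ₁, hφ₁⟩ : ∃ φ₁ : ℝ → ℝ → ℝ, φ₁ = fun R θ => α * (R * dz Φ R θ) := ⟨_, rfl⟩
  have hφ₁c : ContDiff ℝ 1 (uncurry φ₁) := by
    rw [hφ₁]
    have e : uncurry (fun R θ => α * (R * dz Φ R θ)) = fun p : ℝ × ℝ => α * (p.1 * uncurry (dz Φ) p) := by funext p; rfl
    rw [e]; exact contDiff_const.mul (contDiff_fst.mul (contDiff_dz_of_contDiff (n := 1) hΦ2))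
  have eφ₁ : uncurry (fun R θ => α * (R * dz Φ R θ)) = fun p : ℝ × ℝ => (α * p.1) * uncurry (dz Φ) p := by
    funext p; simp [uncurry]; ring
  have hφ₁s : HasCompactSupport (uncurry φ₁) := by rw [hφ₁, eφ₁]; exact (hasCompactSupport_dz hΦs).mul_left
  have hφ₁S : tsupport (uncurry φ₁) ⊆ strip := by
    rw [hφ₁, eφ₁]; exact (tsupport_mul_subset_right.trans tsupport_dz_subset).trans hΦS
  have hφ₂c : ContDiff ℝ 1 (uncurry (dθ Φ)) := contDiff_dθ_of_contDiff (n := 1) hΦ2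
  have hφ₂s : HasCompactSupport (uncurry (dθ Φ)) := hasCompactSupport_dθ_of hΦs
  have hφ₂S : tsupport (uncurry (dθ Φ)) ⊆ strip := (tsupport_dθ_subset' Φ).trans hΦS
  -- the graph integrations by parts
  have r1 := integral_graphFn_one_mul hφ₁c hφ₁s hφ₁S (α := α) h11
  have r2 := integral_graphFn_one_mul hΦ1 hΦs hΦS (α := α) h11
  have r3 := integral_graphFn_two_mul hφ₂c hφ₂s hφ₂S (α := α) h11
  have r4 := integral_graphFn_three_mul (α := α) χ₁ (dθ Φ)
  simp only [hφ₁, dz_radialWeight hΦ2] at r1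
  rw [g10] at r1 r2 r3 r4
  simp only [] at r1 r2 r3 r4
  -- continuity / support bookkeeping
  have cg11 : Continuous (graphFn α χ₁ 1) := continuous_graphFn h11 1
  have cg12 : Continuous (graphFn α χ₁ 2) := continuous_graphFn h11 2
  have cg13 : Continuous (graphFn α χ₁ 3) := continuous_graphFn h11 3
  have cΨ : Continuous fun p : ℝ × ℝ => Ψt p.1 p.2 := (hΨn 0).continuous
  have cΦ : Continuous fun p : ℝ × ℝ => Φ p.1 p.2 := hΦ1.continuous
  have cdz : Continuous fun p : ℝ × ℝ => dz Φ p.1 p.2 := (contDiff_dz_of_contDiff (n := 0) hΦ1).continuous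
  have cdz2 : Continuous fun p : ℝ × ℝ => dz (dz Φ) p.1 p.2 :=
    (contDiff_dz_of_contDiff (n := 0) (contDiff_dz_of_contDiff (n := 1) hΦ2)).continuous
  have cdθ : Continuous fun p : ℝ × ℝ => dθ Φ p.1 p.2 := hφ₂c.continuous
  have cdθ2 : Continuous fun p : ℝ × ℝ => dθ (dθ Φ) p.1 p.2 := (contDiff_dθ_of_contDiff (n := 0) hφ₂c).continuous
  have sΦ : HasCompactSupport fun p : ℝ × ℝ => Φ p.1 p.2 := hΦs
  have sdz : HasCompactSupport fun p : ℝ × ℝ => dz Φ p.1 p.2 := hasCompactSupport_dz hΦs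
  have sdz2 : HasCompactSupport fun p : ℝ × ℝ => dz (dz Φ) p.1 p.2 := hasCompactSupport_dz (hasCompactSupport_dz hΦs)
  have sdθ : HasCompactSupport fun p : ℝ × ℝ => dθ Φ p.1 p.2 := hφ₂s
  have sdθ2 : HasCompactSupport fun p : ℝ × ℝ => dθ (dθ Φ) p.1 p.2 := hasCompactSupport_dθ_of hφ₂s
  -- integrability of the five weak terms
  have i1 : Integrable fun p : ℝ × ℝ => graphFn α χ₁ 1 p * (α * (p.1 * dz Φ p.1 p.2)) :=
    (cg11.mul (by fun_prop)).integrable_of_hasCompactSupport ((sdz.mul_left (f := fun p : ℝ × ℝ => p.1)).mul_left.mul_left)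
  have i2 : Integrable fun p : ℝ × ℝ => (α - 5) * (graphFn α χ₁ 1 p * Φ p.1 p.2) :=
    ((cg11.mul cΦ).integrable_of_hasCompactSupport sΦ.mul_left).const_mul _
  have i3 : Integrable fun p : ℝ × ℝ => graphFn α χ₁ 2 p * dθ Φ p.1 p.2 := (cg12.mul cdθ).integrable_of_hasCompactSupport sdθ.mul_left
  have i4 : Integrable fun p : ℝ × ℝ => graphFn α χ₁ 3 p * dθ Φ p.1 p.2 := (cg13.mul cdθ).integrable_of_hasCompactSupport sdθ.mul_left
  have i5 : Integrable fun p : ℝ × ℝ => 6 * (Ψt p.1 p.2 * Φ p.1 p.2) := ((cΨ.mul cΦ).integrable_of_hasCompactSupport sΦ.mul_left).const_mul _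
  have split : (∫ p in strip, (graphFn α χ₁ 1 p * (α * (p.1 * dz Φ p.1 p.2)) + (α - 5) * (graphFn α χ₁ 1 p * Φ p.1 p.2) +
      graphFn α χ₁ 2 p * dθ Φ p.1 p.2 - graphFn α χ₁ 3 p * dθ Φ p.1 p.2 - 6 * (Ψt p.1 p.2 * Φ p.1 p.2))) =
      (∫ p in strip, graphFn α χ₁ 1 p * (α * (p.1 * dz Φ p.1 p.2))) + (α - 5) * (∫ p in strip, graphFn α χ₁ 1 p * Φ p.1 p.2) +
      (∫ p in strip, graphFn α χ₁ 2 p * dθ Φ p.1 p.2) - (∫ p in strip, graphFn α χ₁ 3 p * dθ Φ p.1 p.2) -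
      6 * ∫ p in strip, Ψt p.1 p.2 * Φ p.1 p.2 := by
    rw [integral_sub, integral_sub, integral_add, integral_add, MeasureTheory.integral_const_mul, MeasureTheory.integral_const_mul]
    · exact i1.integrableOn
    · exact i2.integrableOn
    · exact (i1.add i2).integrableOn
    · exact i3.integrableOn
    · exact ((i1.add i2).add i3).integrableOn
    · exact i4.integrableOn
    · exact (((i1.add i2).add i3).sub i4).integrableOn
    · exact i5.integrableOn
  rw [split, r1, r2, r3, r4]
  -- integrability of the five strong terms and the final pointwise identity
  set hA : ℝ × ℝ → ℝ := fun p => α * (p.1 * dz Φ p.1 p.2) + p.1 * (α * (dz Φ p.1 p.2 + p.1 * dz (dz Φ) p.1 p.2)) with hhA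
  set hB : ℝ × ℝ → ℝ := fun p => Φ p.1 p.2 + p.1 * dz Φ p.1 p.2 with hhB
  set hC : ℝ × ℝ → ℝ := fun p => dθ (dθ Φ) p.1 p.2 with hhC
  set hD : ℝ × ℝ → ℝ := fun p => Real.tan p.2 * dθ Φ p.1 p.2 with hhD
  set hE : ℝ × ℝ → ℝ := fun p => Φ p.1 p.2 with hhE
  have jA : Integrable fun p : ℝ × ℝ => Ψt p.1 p.2 * hA p := (cΨ.mul (by simp only [hhA]; fun_prop)).integrable_of_hasCompactSupport
    (((sdz.mul_left (f := fun p : ℝ × ℝ => p.1)).mul_left.add ((sdz.add (sdz2.mul_left (f := fun p : ℝ × ℝ => p.1))).mul_left.mul_left)).mul_left)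
  have jB : Integrable fun p : ℝ × ℝ => Ψt p.1 p.2 * hB p := (cΨ.mul (by simp only [hhB]; fun_prop)).integrable_of_hasCompactSupport
    ((sΦ.add (sdz.mul_left (f := fun p : ℝ × ℝ => p.1))).mul_left)
  have jC : Integrable fun p : ℝ × ℝ => Ψt p.1 p.2 * hC p := (cΨ.mul cdθ2).integrable_of_hasCompactSupport sdθ2.mul_left
  have jD : Integrable fun p : ℝ × ℝ => Ψt p.1 p.2 * hD p :=
    (cΨ.mul (continuous_tan_mul_test hφ₂c hφ₂S)).integrable_of_hasCompactSupport (sdθ.mul_left.mul_left)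
  have jE : Integrable fun p : ℝ × ℝ => Ψt p.1 p.2 * hE p := (cΨ.mul cΦ).integrable_of_hasCompactSupport sΦ.mul_left
  have eT : (fun p : ℝ × ℝ => Ψt p.1 p.2 * transposeOp α Φ p) = fun p =>
      (-α) * (Ψt p.1 p.2 * hA p) + (-α * (α - 5)) * (Ψt p.1 p.2 * hB p) +
        (-1) * (Ψt p.1 p.2 * hC p) + (-1) * (Ψt p.1 p.2 * hD p) + (-6) * (Ψt p.1 p.2 * hE p) := by
    funext p
    simp only [transposeOp_apply, hhA, hhB, hhC, hhD, hhE]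
    ring
  rw [eT, integral_add, integral_add, integral_add, integral_add, MeasureTheory.integral_const_mul, MeasureTheory.integral_const_mul,
    MeasureTheory.integral_const_mul, MeasureTheory.integral_const_mul, MeasureTheory.integral_const_mul]
  · ring
  all_goals first
    | exact (jA.const_mul _).integrableOn
    | exact ((jA.const_mul _).add (jB.const_mul _)).integrableOn
    | exact (((jA.const_mul _).add (jB.const_mul _)).add (jC.const_mul _)).integrableOn
    | exact ((((jA.const_mul _).add (jB.const_mul _)).add (jC.const_mul _)).add (jD.const_mul _)).integrableOn
    | exact (jB.const_mul _).integrableOn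
    | exact (jC.const_mul _).integrableOn
    | exact (jD.const_mul _).integrableOn
    | exact (jE.const_mul _).integrableOn

/-! ### Localisation to the compactly supported class -/

/-- **Localisation**: a function smooth on the strip agrees, on a neighbourhood of a compact
`K ⊆ strip`, with a smooth function compactly supported in the strip. [folklore] -/
theorem exists_test_eqOn {Ψ : ℝ × ℝ → ℝ} (hΨ : ContDiffOn ℝ ∞ Ψ strip) {K : Set (ℝ × ℝ)} (hK : IsCompact K) (hKS : K ⊆ strip) :
    ∃ (W : Set (ℝ × ℝ)) (Ψt : ℝ × ℝ → ℝ), IsOpen W ∧ K ⊆ W ∧ W ⊆ strip ∧ ContDiff ℝ ∞ Ψt ∧ HasCompactSupport Ψt ∧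
      tsupport Ψt ⊆ strip ∧ EqOn Ψt Ψ W := by
  obtain ⟨δ, hδ, hδS⟩ := hK.exists_cthickening_subset_open isOpen_strip hKS
  have hδ4 : 0 < δ / 4 := by positivity
  obtain ⟨ρ, hρ, -, -, hρ1, hρs, -⟩ := exists_smooth_cutoff K hδ4
  have h3 : thickening (3 * (δ / 4)) K ⊆ cthickening δ K := thickening_subset_cthickening_of_le (by linarith) K
  have hρS : tsupport ρ ⊆ strip := (hρs.trans h3).trans hδS
  have hρc : HasCompactSupport ρ := by
    refine IsCompact.of_isClosed_subset ?_ (isClosed_tsupport ρ) (hρs.trans h3)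
    exact Metric.isCompact_of_isClosed_isBounded isClosed_cthickening hK.isBounded.cthickening
  refine ⟨thickening (δ / 4) K, fun x => ρ x * Ψ x, isOpen_thickening, self_subset_thickening hδ4 K,
    ((thickening_subset_cthickening_of_le (by linarith) K).trans hδS), contDiff_mul_of_tsupport_subset isOpen_strip hρ hρS hΨ,
    hρc.mul_right, (tsupport_mul_subset_left.trans hρS), fun x hx => ?_⟩
  show ρ x * Ψ x = Ψ x
  rw [hρ1 x hx, one_mul]

/-! ### The classical equation -/

/-- `L` of the compactly supported smooth class is continuous on the strip. [folklore] -/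
theorem continuousOn_ellipticOp_test (α : ℝ) {Ψt : ℝ → ℝ → ℝ} (hΨn : ∀ n : ℕ, ContDiff ℝ n (uncurry Ψt))
    (hΨs : HasCompactSupport (uncurry Ψt)) (hΨS : tsupport (uncurry Ψt) ⊆ strip) :
    ContinuousOn (fun p : ℝ × ℝ => ellipticOp α Ψt p.1 p.2) strip := by
  obtain ⟨χ₁, h1n, h1s, h1pos, h10, hcos1⟩ := exists_profile_of_test hΨn hΨs hΨS
  obtain ⟨gF, hgF⟩ : ∃ gF : ℝ → ℝ → ℝ, gF = fun R θ => -α ^ 2 * R ^ 2 * dz (dz Ψt) R θ - α * (5 + α) * R * dz Ψt R θ -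
      dθ (dθ Ψt) R θ + (Real.cos θ * χ₁ R θ + Real.sin θ * dθ χ₁ R θ) - 6 * Ψt R θ := ⟨_, rfl⟩
  have heq := ellipticOp_eq_smoothRep α hcos1.symm hgF (h1n 2)
  have hc : Continuous (uncurry gF) := (contDiff_smoothRep α hcos1.symm hgF (n := 0) (by exact_mod_cast h1n 2)).continuous
  exact (hc.continuousOn (s := strip)).congr fun p hp => heq p hp

set_option maxHeartbeats 1600000 in
/-- **The smooth representative is a classical solution**: if `Ψ ∈ C^∞(strip)` agrees a.e. on the
strip with the first component `U₀` of the weak solution with smooth datum `f ⊥ K`, then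
`L(Ψ) = f` pointwise on the open strip. [cite: Elgindi2021, §7.1 Proposition 7.1 (p. 19 of arXiv:1904.04795)] -/
theorem ellipticOp_rep_eq {α : ℝ} (hα : 0 < α) {f : ℝ × ℝ → ℝ} (hfc : Continuous f) (hfs : HasCompactSupport f)
    (hf : ContDiffOn ℝ ∞ f strip)
    (HF : ∀ n : ℝ → ℝ, Continuous n → HasCompactSupport n → ∫ p in strip, f p * (n p.1 * kernelK p.2) = 0)
    {U : E4} (hU : U ∈ weakSpace α) (hw : ∀ Φ ∈ weakSpace α, energyForm α U Φ = ⟪toL2 f, Φ 0⟫_ℝ)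
    {Ψ : ℝ × ℝ → ℝ} (hΨ : ContDiffOn ℝ ∞ Ψ strip) (hae : ∀ᵐ y ∂(volume : Measure (ℝ × ℝ)), y ∈ strip → (U 0 : ℝ × ℝ → ℝ) y = Ψ y) :
    ∀ p ∈ strip, ellipticOp α (fun R θ => Ψ (R, θ)) p.1 p.2 = f p := by
  have _hα := hα
  set Ψc : ℝ → ℝ → ℝ := fun R θ => Ψ (R, θ) with hΨc
  set g : ℝ × ℝ → ℝ := fun p => ellipticOp α Ψc p.1 p.2 - f p with hg
  -- continuity of `L(Ψ)` on the strip (locally it is `L` of a compactly supported smooth function)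
  have hLc : ContinuousOn (fun p : ℝ × ℝ => ellipticOp α Ψc p.1 p.2) strip := by
    intro p hp
    obtain ⟨W, Ψt, hW, hpW, hWS, hΨt, hΨts, hΨtS, hEq⟩ := exists_test_eqOn hΨ isCompact_singleton (singleton_subset_iff.2 hp)
    have hpW' : p ∈ W := hpW (mem_singleton p)
    set Ψtc : ℝ → ℝ → ℝ := fun R θ => Ψt (R, θ) with hΨtc
    have eut : uncurry Ψtc = Ψt := by funext q; rfl
    have hΨtn : ∀ n : ℕ, ContDiff ℝ n (uncurry Ψtc) := fun n => by
      rw [eut]; exact hΨt.of_le (by exact_mod_cast (le_top : (n : ℕ∞) ≤ ⊤))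
    have hΨts' : HasCompactSupport (uncurry Ψtc) := by rw [eut]; exact hΨts
    have hΨtS' : tsupport (uncurry Ψtc) ⊆ strip := by rw [eut]; exact hΨtS
    have hc := continuousOn_ellipticOp_test α hΨtn hΨts' hΨtS'
    have heq : ∀ q ∈ W, ellipticOp α Ψtc q.1 q.2 = ellipticOp α Ψc q.1 q.2 := fun q hq =>
      eqOn_ellipticOp α hW (fun r hr => by show Ψt (r.1, r.2) = Ψ (r.1, r.2); exact hEq hr) hq
    have h1 : ContinuousAt (fun q : ℝ × ℝ => ellipticOp α Ψtc q.1 q.2) p := (hc p hp).continuousAt (isOpen_strip.mem_nhds hp)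
    have h2 : (fun q : ℝ × ℝ => ellipticOp α Ψtc q.1 q.2) =ᶠ[𝓝 p] fun q => ellipticOp α Ψc q.1 q.2 := by
      filter_upwards [hW.mem_nhds hpW'] with q hq using heq q hq
    exact (h1.congr h2).continuousWithinAt
  have hgc : ContinuousOn g strip := hLc.sub hf.continuousOn
  -- the pairing with every test function vanishes
  have hpair : ∀ φ : ℝ × ℝ → ℝ, ContDiff ℝ ∞ φ → HasCompactSupport φ → tsupport φ ⊆ strip →
      ∫ x, φ x • g x ∂(volume : Measure (ℝ × ℝ)) = 0 := by
    intro φ hφ hφs hφS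
    set Φ : ℝ → ℝ → ℝ := fun R θ => φ (R, θ) with hΦ
    have euc : uncurry Φ = φ := by funext q; rfl
    have hΦn : ∀ n : ℕ, ContDiff ℝ n (uncurry Φ) := fun n => by rw [euc]; exact hφ.of_le (by exact_mod_cast (le_top : (n : ℕ∞) ≤ ⊤))
    have hΦs : HasCompactSupport (uncurry Φ) := by rw [euc]; exact hφs
    have hΦS : tsupport (uncurry Φ) ⊆ strip := by rw [euc]; exact hφS
    -- localise `Ψ` near the support of `φ`
    obtain ⟨W, Ψt, hW, hKW, hWS, hΨt, hΨts, hΨtS, hEq⟩ := exists_test_eqOn hΨ hφs (by rw [← euc]; exact hΦS)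
    set Ψtc : ℝ → ℝ → ℝ := fun R θ => Ψt (R, θ) with hΨtc
    have eut : uncurry Ψtc = Ψt := by funext q; rfl
    have hΨtn : ∀ n : ℕ, ContDiff ℝ n (uncurry Ψtc) := fun n => by rw [eut]; exact hΨt.of_le (by exact_mod_cast (le_top : (n : ℕ∞) ≤ ⊤))
    have hΨts' : HasCompactSupport (uncurry Ψtc) := by rw [eut]; exact hΨts
    have hΨtS' : tsupport (uncurry Ψtc) ⊆ strip := by rw [eut]; exact hΨtS
    have heqL : ∀ q ∈ W, ellipticOp α Ψtc q.1 q.2 = ellipticOp α Ψc q.1 q.2 := fun q hq =>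
      eqOn_ellipticOp α hW (fun r hr => by show Ψt (r.1, r.2) = Ψ (r.1, r.2); exact hEq hr) hq
    -- `∫ φ g = ∫_strip (LΨ)Φ − ∫_strip fΦ`
    have e0 : ∫ x, φ x • g x ∂(volume : Measure (ℝ × ℝ)) = ∫ x in strip, φ x * g x := by
      rw [← setIntegral_eq_integral_of_forall_compl_eq_zero (s := strip) fun x hx => ?_]
      · rfl
      · rw [show φ x = 0 from image_eq_zero_of_notMem_tsupport fun h => hx (hφS h), zero_smul]
    have e1 : ∫ x in strip, φ x * g x = ∫ x in strip, (ellipticOp α Ψtc x.1 x.2 * Φ x.1 x.2 - f x * Φ x.1 x.2) := by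
      refine setIntegral_congr_fun measurableSet_strip fun x hx => ?_
      simp only [hg]
      by_cases hxs : x ∈ tsupport φ
      · rw [heqL x (hKW hxs)]; simp only [hΦ]; ring
      · rw [show φ x = 0 from image_eq_zero_of_notMem_tsupport hxs]
        simp only [hΦ]
        rw [show φ (x.1, x.2) = 0 from image_eq_zero_of_notMem_tsupport hxs]; ring
    have cL : Continuous fun x : ℝ × ℝ => ellipticOp α Ψtc x.1 x.2 * Φ x.1 x.2 := by
      -- equals the smooth representative times `Φ` everywhere (off the strip `Φ = 0`)
      obtain ⟨χ₁, h1n, h1s, h1pos, h10, hcos1⟩ := exists_profile_of_test hΨtn hΨts' hΨtS'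
      obtain ⟨gF, hgF⟩ : ∃ gF : ℝ → ℝ → ℝ, gF = fun R θ => -α ^ 2 * R ^ 2 * dz (dz Ψtc) R θ - α * (5 + α) * R * dz Ψtc R θ -
          dθ (dθ Ψtc) R θ + (Real.cos θ * χ₁ R θ + Real.sin θ * dθ χ₁ R θ) - 6 * Ψtc R θ := ⟨_, rfl⟩
      have heq := ellipticOp_eq_smoothRep α hcos1.symm hgF (h1n 2)
      have hc : Continuous (uncurry gF) := (contDiff_smoothRep α hcos1.symm hgF (n := 0) (by exact_mod_cast h1n 2)).continuous
      have e : (fun x : ℝ × ℝ => ellipticOp α Ψtc x.1 x.2 * Φ x.1 x.2) = fun x => uncurry gF x * Φ x.1 x.2 := by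
        funext x
        by_cases hx : x ∈ strip
        · rw [heq x hx]; rfl
        · have : Φ x.1 x.2 = 0 := image_eq_zero_of_notMem_tsupport (f := uncurry Φ) fun h => hx (hΦS h)
          rw [this, mul_zero, mul_zero]
      rw [e]; exact hc.mul (hΦn 0).continuous
    have iL : Integrable fun x : ℝ × ℝ => ellipticOp α Ψtc x.1 x.2 * Φ x.1 x.2 := cL.integrable_of_hasCompactSupport hΦs.mul_left
    have iF : Integrable fun x : ℝ × ℝ => f x * Φ x.1 x.2 := (hfc.mul (hΦn 0).continuous).integrable_of_hasCompactSupport hΦs.mul_left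
    rw [e0, e1, integral_sub iL.integrableOn iF.integrableOn, integral_ellipticOp_mul_test α hΨtn hΨts' hΨtS' hΦn hΦs hΦS]
    -- `∫ Ψ̃ ᵗLΦ = ∫ U₀ ᵗLΦ = ∫ f Φ`
    have e2 : ∫ x in strip, Ψtc x.1 x.2 * transposeOp α Φ x = ∫ x in strip, (U 0 : ℝ × ℝ → ℝ) x * transposeOp α Φ x := by
      refine integral_congr_ae ?_
      have hae' : ∀ᵐ y ∂(volume.restrict strip), (U 0 : ℝ × ℝ → ℝ) y = Ψ y := (ae_restrict_iff' measurableSet_strip).2 hae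
      filter_upwards [hae'] with x hx
      by_cases hxs : x ∈ tsupport φ
      · show Ψt (x.1, x.2) * _ = _
        rw [hEq (hKW hxs), hx]
      · rw [transposeOp_eq_zero_of_notMem α (by rw [euc]; exact hxs), mul_zero, mul_zero]
    rw [e2, integral_weakSol_transposeOp (orth_toL2 hfc hfs HF) hU hw hΦn hΦs hΦS]
    have e3 : ∫ x in strip, (toL2 f : ℝ × ℝ → ℝ) x * Φ x.1 x.2 = ∫ x in strip, f x * Φ x.1 x.2 := by
      refine integral_congr_ae ?_
      filter_upwards [toL2_ae_eq' (memLp_strip_of_continuous hfc hfs)] with x hx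
      rw [hx]
    rw [e3, sub_self]
  -- fundamental lemma and continuity
  have hae0 := isOpen_strip.ae_eq_zero_of_integral_contDiff_smul_eq_zero (hgc.locallyIntegrableOn measurableSet_strip) hpair
  have hEq0 : EqOn g 0 strip := by
    refine Measure.eqOn_open_of_ae_eq (μ := (volume : Measure (ℝ × ℝ))) ?_ isOpen_strip hgc continuousOn_const
    exact (ae_restrict_iff' measurableSet_strip).2 hae0
  intro p hp
  have := hEq0 hp
  simp only [hg, Pi.zero_apply, sub_eq_zero] at this
  exact this

end Elgindi

end Literature.Analysis.FluidPDE
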